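import Mathlib
import Literature.RingTheory.Multisymmetric.Weyl

/-!
# Multisymmetric power sums: linear independence of power-sum monomials with few parts

Continuation of `Literature/RingTheory/Multisymmetric/Weyl.lean` (same notation: `n` vectors with
coordinates `ι`, variables `X (i, j)`, column monomials `U_j^β = colMonomial ι n j β`, polarized power
sums `p_β = powerSum ι n β = ∑_j U_j^β`).

A *vector partition* is a finitely supported multiplicity function `s : (ι →₀ ℕ) →₀ ℕ` on
multi-exponents (its parts are the `β` with `s β ≠ 0`, counted `s β` times; the number of parts is
`s.degree`).  Its power-sum monomial is `powerSumProd ι n s = ∏_β p_β ^ (s β)`.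

**Theorem** (`powerSumProd_linearIndependent`).  Over a field of characteristic zero the power-sum
monomials of the vector partitions with NONZERO parts and AT MOST `n` PARTS are linearly independent
in `k[V^n]`.  (With more than `n` parts there are relations, e.g. for `n = 1` one has
`p_β p_γ = p_{β+γ}`; the bound is sharp.)  This is the easy half of the classical fact that the
polarized power sums of degree `≤ n` generate the multisymmetric functions of `n` vectors FREELY up
to degree `n` (P. A. MacMahon, *Combinatory Analysis* II, §XI; J. Dalbec, Beiträge Algebra Geom. 40
(1999), §1; M. Domokos, arXiv:0706.2154, §2); it is used in
`Literature/RingTheory/Multisymmetric/LowDegreeFreeness.lean` to show that monomials of weighted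
degree `≤ n` in the elementary multisymmetric polynomials are linearly independent.

Proof.  Expand `∏_β p_β^{s β}` over PLACEMENTS of the occurrences of the parts at the `n` vectors
(`powerSumProd_eq_sum_placements`).  Place the parts of `s₀` at distinct vectors (possible as there
are at most `n` of them); the resulting "separated" monomial has a positive coefficient in the
power-sum monomial of `s₀`, and does not occur in that of any other `s` with at most as many parts
(`eq_of_placeExp_eq`: a placement of the parts of `s` producing it is forced to be a bijection onto
the parts of `s₀` matching the parts).  A vanishing linear combination is then contradicted at a term
with the maximal number of parts.
-/

noncomputable section

open MvPolynomial

namespace Literature.RingTheory.Multisymmetric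

variable {k : Type*} [Field k] (ι : Type*) [Fintype ι] [DecidableEq ι] (n : ℕ)

/-! ### Power-sum monomials and placements -/

/-- The power-sum monomial `∏_β p_β ^ (s β)` of a vector partition `s` (a multiplicity function on
multi-exponents `β : ι →₀ ℕ`). [cite: Domokos2009, §2 (products of the invariants [w])] -/
def powerSumProd (s : (ι →₀ ℕ) →₀ ℕ) : MvPolynomial (ι × Fin n) k :=
  s.prod fun β e => powerSum ι n β ^ e

variable {ι n}

/-- The type of OCCURRENCES of parts of a vector partition `s`: the part `β` occurs `s β` times.
[folklore] -/
abbrev Occ (s : (ι →₀ ℕ) →₀ ℕ) : Type _ :=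
  Σ β : ↥s.support, Fin (s β.1)

/-- The part carried by an occurrence. [folklore] -/
def occPart {s : (ι →₀ ℕ) →₀ ℕ} (o : Occ s) : ι →₀ ℕ :=
  o.1.1

omit [Fintype ι] [DecidableEq ι] in
/-- The number of occurrences is the number of parts `s.degree = ∑_β s β`. [folklore] -/
theorem card_occ (s : (ι →₀ ℕ) →₀ ℕ) : Fintype.card (Occ s) = s.degree := by
  rw [Fintype.card_sigma, Finsupp.degree_apply, ← Finset.sum_coe_sort s.support]
  simp only [Fintype.card_fin]

omit [Fintype ι] in
/-- The number of occurrences carrying a given part `β` is its multiplicity `s β`. [folklore] -/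
theorem card_filter_occPart_eq (s : (ι →₀ ℕ) →₀ ℕ) (β : ι →₀ ℕ) :
    (Finset.univ.filter fun o : Occ s => occPart o = β).card = s β := by
  classical
  rw [Finset.card_filter, Fintype.sum_sigma]
  have h : ∀ x : ↥s.support, (∑ _j : Fin (s x.1), (if occPart (⟨x, _j⟩ : Occ s) = β then 1 else 0))
      = if x.1 = β then s x.1 else 0 := by
    intro x
    simp only [occPart]
    split_ifs <;> simp
  rw [Fintype.sum_congr _ _ h]
  by_cases hβ : β ∈ s.support
  · rw [Fintype.sum_eq_single (⟨β, hβ⟩ : ↥s.support)]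
    · simp
    · intro x hx
      rw [if_neg]
      exact fun h' => hx (Subtype.ext h')
  · rw [Finsupp.notMem_support_iff.mp hβ]
    exact Finset.sum_eq_zero fun x _ => if_neg fun h' => hβ (by rw [← h']; exact x.2)

omit [Fintype ι] [DecidableEq ι] in
/-- The power-sum monomial is the product of the power sums of the occurrences of its parts.
[folklore] -/
theorem powerSumProd_eq_prod_occ (s : (ι →₀ ℕ) →₀ ℕ) :
    powerSumProd (k := k) ι n s = ∏ o : Occ s, powerSum ι n (occPart o) := by
  rw [powerSumProd, Finsupp.prod, ← Finset.prod_coe_sort s.support, Fintype.prod_sigma]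
  refine Fintype.prod_congr _ _ fun x => ?_
  change powerSum ι n x.1 ^ s x.1 = ∏ _y : Fin (s x.1), powerSum ι n x.1
  rw [Fin.prod_const]

/-- The exponent produced by a PLACEMENT `φ` of the occurrences at vectors: the sum of the parts,
each placed in the column of its vector. [folklore] -/
def placeExp {s : (ι →₀ ℕ) →₀ ℕ} (φ : Occ s → Fin n) : ι × Fin n →₀ ℕ :=
  ∑ o : Occ s, (occPart o).mapDomain fun i => (i, φ o)

omit [Fintype ι] in
/-- **Expansion of the power-sum monomial over placements** of the occurrences at vectors.
[folklore] -/
theorem powerSumProd_eq_sum_placements (s : (ι →₀ ℕ) →₀ ℕ) :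
    powerSumProd ι n s = ∑ φ : Occ s → Fin n, monomial (placeExp φ) (1 : k) := by
  classical
  rw [powerSumProd_eq_prod_occ]
  simp only [powerSum, colMonomial]
  rw [Finset.prod_univ_sum (fun _ => (Finset.univ : Finset (Fin n)))
    (fun o j => (monomial ((occPart o).mapDomain fun i => (i, j)) (1 : k) :
      MvPolynomial (ι × Fin n) k))]
  rw [Fintype.piFinset_univ]
  refine Finset.sum_congr rfl fun φ _ => ?_
  rw [placeExp, monomial_sum_one]

omit [Fintype ι] in
/-- The coefficient of a monomial in the power-sum monomial counts the placements producing it.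
[folklore] -/
theorem coeff_powerSumProd (s : (ι →₀ ℕ) →₀ ℕ) (e : ι × Fin n →₀ ℕ) :
    coeff e (powerSumProd (k := k) ι n s) =
      ((Finset.univ.filter fun φ : Occ s → Fin n => placeExp φ = e).card : k) := by
  classical
  rw [powerSumProd_eq_sum_placements, coeff_sum]
  simp only [coeff_monomial]
  rw [Finset.sum_boole]

/-! ### Columns of a placement exponent; rigidity of separated placements -/

omit [DecidableEq ι] in
/-- `cols` is additive. [folklore] -/
theorem cols_add (e e' : ι × Fin n →₀ ℕ) (j : Fin n) :
    cols ι n (e + e') j = cols ι n e j + cols ι n e' j := by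
  ext i; simp

omit [DecidableEq ι] in
/-- `cols` of a finite sum. [folklore] -/
theorem cols_sum {α : Type*} (S : Finset α) (f : α → (ι × Fin n →₀ ℕ)) (j : Fin n) :
    cols ι n (∑ x ∈ S, f x) j = ∑ x ∈ S, cols ι n (f x) j := by
  classical
  induction S using Finset.induction_on with
  | empty => ext i; simp
  | insert x S hx ih => rw [Finset.sum_insert hx, Finset.sum_insert hx, cols_add, ih]

omit [DecidableEq ι] in
/-- The `j`-th column of the part `β` placed in column `j'`. [folklore] -/
theorem cols_mapDomain (β : ι →₀ ℕ) (j j' : Fin n) :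
    cols ι n (β.mapDomain fun i => (i, j')) j = if j = j' then β else 0 := by
  ext i
  rw [cols_apply]
  split_ifs with h
  · subst h
    exact Finsupp.mapDomain_apply (fun a b hab => (Prod.ext_iff.mp hab).1) β i
  · rw [Finsupp.mapDomain_notin_range β _ (by rintro ⟨i', hi'⟩; exact h (Prod.ext_iff.mp hi').2.symm)]
    rfl

omit [DecidableEq ι] in
/-- The `j`-th column of a placement exponent is the sum of the parts placed at `j`. [folklore] -/
theorem cols_placeExp {s : (ι →₀ ℕ) →₀ ℕ} (φ : Occ s → Fin n) (j : Fin n) :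
    cols ι n (placeExp φ) j = ∑ o ∈ Finset.univ.filter (fun o => φ o = j), occPart o := by
  classical
  rw [placeExp, cols_sum, Finset.sum_filter]
  refine Finset.sum_congr rfl fun o _ => ?_
  rw [cols_mapDomain]
  by_cases h : φ o = j
  · rw [if_pos h.symm, if_pos h]
  · rw [if_neg (Ne.symm h), if_neg h]

/-- **Rigidity of separated placements.**  Let the parts of `s₀` be nonzero and placed at DISTINCT
vectors (`ψ` injective), and let `φ` be a placement of the occurrences of `s` (nonzero parts, at most
as many parts as `s₀`) producing the same exponent.  Then `s = s₀`. [folklore] -/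
theorem eq_of_placeExp_eq {s s₀ : (ι →₀ ℕ) →₀ ℕ} (hs : ∀ β ∈ s.support, β ≠ 0)
    (hs₀ : ∀ β ∈ s₀.support, β ≠ 0) (ψ : Occ s₀ ↪ Fin n) (φ : Occ s → Fin n)
    (hφ : placeExp φ = placeExp ψ) (hcard : Fintype.card (Occ s) ≤ Fintype.card (Occ s₀)) :
    s = s₀ := by
  classical
  have hpart : ∀ o : Occ s, occPart o ≠ 0 := fun o => hs _ o.1.2
  have hpart₀ : ∀ o : Occ s₀, occPart o ≠ 0 := fun o => hs₀ _ o.1.2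
  -- column sums agree at every vector
  have hcol : ∀ j, ∑ o ∈ Finset.univ.filter (fun o => φ o = j), occPart o =
      ∑ o ∈ Finset.univ.filter (fun o => ψ o = j), occPart o := by
    intro j
    rw [← cols_placeExp, ← cols_placeExp, hφ]
  -- the `ψ`-column at `ψ o'` is the single part of `o'`
  have hcolψ : ∀ o' : Occ s₀,
      ∑ o ∈ Finset.univ.filter (fun o => ψ o = ψ o'), occPart o = occPart o' := by
    intro o'
    have : Finset.univ.filter (fun o => ψ o = ψ o') = {o'} := by
      ext o
      simp only [Finset.mem_filter, Finset.mem_univ, true_and, Finset.mem_singleton]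
      exact ⟨fun h => ψ.injective h, fun h => by rw [h]⟩
    rw [this, Finset.sum_singleton]
  -- every vector used by `φ` is in the range of `ψ`
  have hrange : ∀ o : Occ s, ∃ o' : Occ s₀, ψ o' = φ o := by
    intro o
    by_contra hne
    push Not at hne
    have h0 : ∑ o'' ∈ Finset.univ.filter (fun o'' => ψ o'' = φ o), occPart o'' = 0 :=
      Finset.sum_eq_zero fun o'' ho'' => absurd (Finset.mem_filter.mp ho'').2 (hne o'')
    have h1 := hcol (φ o)
    rw [h0, Finset.sum_eq_zero_iff] at h1
    exact hpart o (h1 o (Finset.mem_filter.mpr ⟨Finset.mem_univ _, rfl⟩))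
  choose lift hlift using hrange
  -- `lift` is surjective, hence bijective
  have hsurj : Function.Surjective lift := by
    intro o'
    have h1 := hcol (ψ o')
    rw [hcolψ] at h1
    have hne : (Finset.univ.filter (fun o => φ o = ψ o')).Nonempty := by
      by_contra hemp
      rw [Finset.not_nonempty_iff_eq_empty] at hemp
      rw [hemp, Finset.sum_empty] at h1
      exact hpart₀ o' h1.symm
    obtain ⟨o, ho⟩ := hne
    refine ⟨o, ψ.injective ?_⟩
    rw [hlift, (Finset.mem_filter.mp ho).2]
  have hbij : Function.Bijective lift := by
    rw [Fintype.bijective_iff_surjective_and_card]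
    exact ⟨hsurj, le_antisymm hcard (Fintype.card_le_of_surjective lift hsurj)⟩
  -- the parts match along `lift`
  have hmatch : ∀ o : Occ s, occPart o = occPart (lift o) := by
    intro o
    have h1 := hcol (φ o)
    rw [← hlift o, hcolψ] at h1
    have hfilter : Finset.univ.filter (fun o'' => φ o'' = ψ (lift o)) = {o} := by
      ext o''
      simp only [Finset.mem_filter, Finset.mem_univ, true_and, Finset.mem_singleton]
      constructor
      · intro h
        apply hbij.1
        apply ψ.injective
        rw [hlift, hlift, ← hlift o, h]
      · intro h
        rw [h, hlift]
    rw [hfilter, Finset.sum_singleton] at h1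
    exact h1
  -- count the occurrences of each part
  ext β
  rw [← card_filter_occPart_eq s β, ← card_filter_occPart_eq s₀ β]
  refine Finset.card_bij (fun o _ => lift o) (fun o ho => ?_) (fun o₁ _ o₂ _ h => hbij.1 h)
    (fun o' ho' => ?_)
  · rw [Finset.mem_filter] at ho ⊢
    exact ⟨Finset.mem_univ _, (hmatch o).symm.trans ho.2⟩
  · obtain ⟨o, rfl⟩ := hsurj o'
    refine ⟨o, ?_, rfl⟩
    rw [Finset.mem_filter] at ho' ⊢
    exact ⟨Finset.mem_univ _, (hmatch o).trans ho'.2⟩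

/-! ### Linear independence -/

variable (ι n)

/-- **Linear independence of power-sum monomials with few parts.**  Over a field of characteristic
zero, the power-sum monomials `∏_β p_β^{s β}` of the vector partitions `s` with nonzero parts and at
most `n` parts are linearly independent in `k[V^n]`.
[cite: Domokos2009, §2 (the invariants [w] and their products)] -/
theorem powerSumProd_linearIndependent [CharZero k] :
    LinearIndependent k (fun s : {s : (ι →₀ ℕ) →₀ ℕ // (∀ β ∈ s.support, β ≠ 0) ∧ s.degree ≤ n} =>
      powerSumProd (k := k) ι n s.1) := by
  classical
  rw [linearIndependent_iff']
  intro T g hsum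
  by_contra hcon
  push Not at hcon
  set T' := T.filter (fun i => g i ≠ 0) with hT'
  have hT'ne : T'.Nonempty := by
    obtain ⟨i, hi, hgi⟩ := hcon
    exact ⟨i, Finset.mem_filter.mpr ⟨hi, hgi⟩⟩
  obtain ⟨i₀, hi₀, hmax⟩ := Finset.exists_max_image T' (fun i => i.1.degree) hT'ne
  have hi₀T : i₀ ∈ T := (Finset.mem_filter.mp hi₀).1
  have hgi₀ : g i₀ ≠ 0 := (Finset.mem_filter.mp hi₀).2
  -- separate the parts of `i₀`
  have hcard₀ : Fintype.card (Occ i₀.1) ≤ Fintype.card (Fin n) := by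
    rw [card_occ, Fintype.card_fin]; exact i₀.2.2
  obtain ⟨ψ⟩ := Function.Embedding.nonempty_of_card_le hcard₀
  set e₀ : ι × Fin n →₀ ℕ := placeExp ψ with he₀
  have hcoeff := congrArg (coeff e₀) hsum
  rw [coeff_sum, coeff_zero] at hcoeff
  simp only [coeff_smul, smul_eq_mul] at hcoeff
  -- only `i₀` contributes to the coefficient of the separated monomial
  rw [Finset.sum_eq_single i₀] at hcoeff
  · have hne : coeff e₀ (powerSumProd (k := k) ι n i₀.1) ≠ 0 := by
      rw [coeff_powerSumProd, Nat.cast_ne_zero, ← Nat.pos_iff_ne_zero, Finset.card_pos]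
      exact ⟨ψ, Finset.mem_filter.mpr ⟨Finset.mem_univ _, rfl⟩⟩
    exact hgi₀ ((mul_eq_zero.mp hcoeff).resolve_right hne)
  · intro i hi hne
    by_cases hgi : g i = 0
    · rw [hgi, zero_mul]
    · have hiT' : i ∈ T' := Finset.mem_filter.mpr ⟨hi, hgi⟩
      have hdeg : i.1.degree ≤ i₀.1.degree := hmax i hiT'
      suffices h0 : coeff e₀ (powerSumProd (k := k) ι n i.1) = 0 by rw [h0, mul_zero]
      rw [coeff_powerSumProd, Nat.cast_eq_zero, Finset.card_eq_zero, Finset.filter_eq_empty_iff]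
      intro φ _ hφ
      apply hne
      apply Subtype.ext
      refine eq_of_placeExp_eq i.2.1 i₀.2.1 ψ φ (hφ.trans he₀.symm) ?_
      rw [card_occ, card_occ]
      exact hdeg
  · exact fun h => absurd hi₀T h

end Literature.RingTheory.Multisymmetric
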